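import Summits.ResolutionOfSingularities.ResolutionOfSingularities.Theorems.FrobeniusClosingPatchingRelPerfectConeCubeCharts
import Summits.ResolutionOfSingularities.ResolutionOfSingularities.Theorems.FrobeniusClosingPatchingRelPerfectLetterTowerTwoAny
import Summits.ResolutionOfSingularities.ResolutionOfSingularities.Theorems.FrobeniusClosingPatchingRelPerfectConeDepthTwo
import Summits.ResolutionOfSingularities.ResolutionOfSingularities.Theorems.FrobeniusClosingPatchingRelPerfectConeTiltCharts
import Literature.AlgebraicGeometry.Resolution.BlowupPointSubalgebra
import HarnessLib

/-!
# Crux `PatchingRelPerfect` (stmt-ResolutionOfSingularities-16161), chain w52 — the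
# CONTACT-MIGRATION member `I = (x₀x₁ + x₂² + x₃³) + 𝔪⁴`: the side charts `i ≤ 2`

[OURS · L1 W5.2 · rung] PLAN-A2-certificate.md addendum 5 step (1) / addendum 6: on the Rees charts
`B_i = S[x/x_i]`, `i = 0, 1, 2`, of `Bl_𝔪 Spec S` (`S` regular local of dimension four with regular
system of parameters `x₀, …, x₃`) the total transform of `I · Q₀`
(`Q₀ = A₀₂ A₁₀ A₁₁ A₁₂ (P + 𝔪²)`, `…ConeCubeCharts`) is `u¹¹ · ∏_{s<4} (F♯, L₀⋯L_s)` with letters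
`L = (u, 1, 1, u)` and `F♯ = e₀e₁ + e₂² + u e₃³ ≡ F (mod u)`; the centre `V(F♯, u) = V(u, F)` is a
regular surface (`isRegularRing_quot_span_u_F_*`, `…ConeMemberLevelOne`), `(F♯, u)` is quasi-regular
(swap of the weakly regular pair `(u, F♯)`, `…PairSwap`), so the two-letter tower
`isRegular_of_isBlowup_letterTower_two''` (`…LetterTowerTwoAny`) makes every blowing up of
`Spec B_i` along `(I · Q₀) B_i` regular: `isRegular_of_isBlowup_cubeIQ_of_ne_three`.

Nothing here is a statement of the manuscript under review.

## References

* The Stacks Project, Tags 080A, 080B, 0804, 0BIQ. [StacksProject]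
* Q. Liu, *Algebraic Geometry and Arithmetic Curves*, OUP 2002, Thm. 8.1.19 (a). [Liu2002]
* H. Matsumura, *Commutative Ring Theory*, CUP 1986, Thm. 16.2. [Matsumura1987]
-/

-- `Summit.<Summit>.<Sub>.Theorems` with `Sub = Summit` (single-conjunct summit, D-0017)
set_option linter.dupNamespace false

noncomputable section

open CategoryTheory CategoryTheory.Limits AlgebraicGeometry Literature.AlgebraicGeometry.Resolution
open IsLocalRing

namespace Summit.ResolutionOfSingularities.ResolutionOfSingularities.Theorems

namespace ConeRung

universe u

section LevelOneRegular

variable {S : Type u} [CommRing S] [IsRegularLocalRing S] (x : Fin 4 → S)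
  (hx : Ideal.span (Set.range x) = IsLocalRing.maximalIdeal S)
  (hd : (IsLocalRing.maximalIdeal S).spanFinrank = 4)

local notation3 "M" => Ideal.span (Set.range x)
local notation3 "PP" => Ideal.span {x 0, x 1, x 2}
local notation3 "fC" => x 0 * x 1 + x 2 ^ 2 + x 3 ^ 3

include hx hd in
/-- **`F♯ = e₀e₁ + e₂² + u e₃³ ∉ (u)`** on every Rees chart (`F♯ ≡ F (mod u)`, `F_notMem_span_u`).
[cite: StacksProject, Tag 0BIQ] -/
theorem Fs_notMem_span_u (i : Fin 4) :
    chartGen x i 0 * chartGen x i 1 + chartGen x i 2 ^ 2 +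
        chartBase x i (x i) * chartGen x i 3 ^ 3 ∉ Ideal.span {chartBase x i (x i)} := by
  intro h
  refine F_notMem_span_u x hx hd i ?_
  have e : chartGen x i 0 * chartGen x i 1 + chartGen x i 2 ^ 2 =
      (chartGen x i 0 * chartGen x i 1 + chartGen x i 2 ^ 2 +
        chartBase x i (x i) * chartGen x i 3 ^ 3) -
      chartBase x i (x i) * chartGen x i 3 ^ 3 := by ring
  rw [e]
  exact Ideal.sub_mem _ h (Ideal.mul_mem_right _ _ (Ideal.subset_span rfl))

omit [IsRegularLocalRing S] in
/-- `(F♯, u) = (u, F)` as ideals. [folklore] -/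
theorem span_Fs_u (i : Fin 4) :
    Ideal.span {chartGen x i 0 * chartGen x i 1 + chartGen x i 2 ^ 2 +
        chartBase x i (x i) * chartGen x i 3 ^ 3, chartBase x i (x i)} =
      Ideal.span {chartBase x i (x i), chartGen x i 0 * chartGen x i 1 + chartGen x i 2 ^ 2} := by
  rw [Ideal.span_pair_comm]
  exact span_pair_add_mul _ _ _

include hx hd in
/-- **`B_i ⧸ (F♯, u)` is a regular ring on the charts `i = 0, 1, 2`** (`= B_i ⧸ (u, F)`, the regular
surface `V(u, F)`; `…ConeMemberLevelOne`). [cite: Liu2002, Thm. 8.1.19 (a)] -/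
theorem isRegularRing_quot_span_Fs_u (i : Fin 4) (hi : i ≠ 3) :
    IsRegularRing (chartRing x i ⧸ Ideal.span {chartGen x i 0 * chartGen x i 1 + chartGen x i 2 ^ 2 +
        chartBase x i (x i) * chartGen x i 3 ^ 3, chartBase x i (x i)}) := by
  rw [span_Fs_u x i]
  fin_cases i
  · exact isRegularRing_quot_span_u_F_zero x hx hd
  · exact isRegularRing_quot_span_u_F_one x hx hd
  · exact isRegularRing_quot_span_u_F_two x hx hd
  · exact absurd rfl hi

include hx hd in
/-- **`(F♯, u)` is a quasi-regular pair** on every chart: `(u, F♯)` is weakly regular (`u` a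
non-zero-divisor with `B_i/(u)` a domain and `F♯ ∉ (u)`), and both are non-zero-divisors of the
domain `B_i`, so the swap lemma applies. [cite: Matsumura1987, Thm. 16.2] -/
theorem isQuasiRegular_Fs_u (i : Fin 4) :
    IsQuasiRegular (Fin.cons (chartGen x i 0 * chartGen x i 1 + chartGen x i 2 ^ 2 +
        chartBase x i (x i) * chartGen x i 3 ^ 3)
      (fun _ : Fin 1 => chartBase x i (x i)) : Fin 2 → chartRing x i) := by
  haveI : IsDomain S := isDomain_of_isRegularLocalRing S
  haveI := isDomain_residue x hx
  have hqr := isQuasiRegular_regularSystemOfParameters hd x hx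
  haveI := isDomain_chartRing_quot_span x i hqr
  have hxi : x i ≠ 0 := (isRsopPart_comp_of_rsop hd x hx id Function.injective_id).ne_zero i
  haveI : IsDomain (chartRing x i) := isDomain_chartRing x i hxi
  haveI : NoZeroDivisors (chartRing x i) := IsDomain.to_noZeroDivisors (chartRing x i)
  have hu : chartBase x i (x i) ∈ nonZeroDivisors (chartRing x i) :=
    reesChartBase_mem_nonZeroDivisors (x i) (Ideal.mem_span_range_self (f := x) (x := i))
  have hFs := Fs_notMem_span_u x hx hd i
  have hFs0 : chartGen x i 0 * chartGen x i 1 + chartGen x i 2 ^ 2 +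
      chartBase x i (x i) * chartGen x i 3 ^ 3 ∈ nonZeroDivisors (chartRing x i) :=
    mem_nonZeroDivisors_of_ne_zero (fun h0 => hFs (by rw [h0]; exact zero_mem _))
  exact isQuasiRegular_pair_swap _ _ hu hFs0 (CoreRungTower.isWeaklyRegular_pair_of_notMem hu hFs)

include hx hd in
/-- **On the charts `i = 0, 1, 2` every blowing up of `Spec B_i` along `(I · Q₀) B_i =
u¹¹ · ∏_{s<4} (F♯, L₀⋯L_s)` is regular** (`L = (u, 1, 1, u)`): twist off `u¹¹` (Stacks 080B) and
apply the two-letter tower `isRegular_of_isBlowup_letterTower_two''` with `c := F♯`, `ℓ := u`.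
[cite: StacksProject, Tag 080A] [cite: StacksProject, Tag 080B] [cite: Liu2002, Thm. 8.1.19 (a)] -/
theorem isRegular_of_isBlowup_cubeIQ_of_ne_three (i : Fin 4) (hi : i ≠ 3) {Y : Scheme.{u}}
    {ρ : Y ⟶ Spec (.of (chartRing x i))}
    (hρ : IsBlowup ρ (affineBlowup.idealSheaf
      (((Ideal.span {fC} ⊔ M ^ 4) * ((Ideal.span {fC} ⊔ (PP ⊔ M ^ 2) ^ 2) *
        (Ideal.span {fC} ⊔ M ^ 3) * (Ideal.span {fC} ⊔ M ^ 2 * (PP ⊔ M ^ 2)) *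
        (Ideal.span {fC} ⊔ M * (PP ⊔ M ^ 2) ^ 2) * (PP ⊔ M ^ 2))).map (chartBase x i)))) :
    Scheme.IsRegular Y := by
  haveI : IsDomain S := isDomain_of_isRegularLocalRing S
  haveI := isRegularRing_chart x hx hd i
  have hxi : x i ≠ 0 := (isRsopPart_comp_of_rsop hd x hx id Function.injective_id).ne_zero i
  haveI : IsDomain (chartRing x i) := isDomain_chartRing x i hxi
  have hu : chartBase x i (x i) ∈ nonZeroDivisors (chartRing x i) :=
    reesChartBase_mem_nonZeroDivisors (x i) (Ideal.mem_span_range_self (f := x) (x := i))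
  have hu0 : chartBase x i (x i) ≠ 0 := nonZeroDivisors.ne_zero hu
  have hu11 : chartBase x i (x i) ^ 11 ∈ nonZeroDivisors (chartRing x i) := pow_mem hu 11
  rw [map_chartBase_cubeIQ_of_ne_three x i hi] at hρ
  exact CoreRungTower.isRegular_of_isBlowup_span_singleton_mul hu11 _
    (fun Y' ρ' h' => isRegular_of_isBlowup_letterTower_two'' 4 _ (chartBase x i (x i))
      (fun r => [chartBase x i (x i), 1, 1, chartBase x i (x i)].getD r 1) (cube_letters_spec x i)
      (isQuasiRegular_Fs_u x hx hd i) (isRegularRing_quot_span_Fs_u x hx hd i hi) hu0 h') hρ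

end LevelOneRegular

end ConeRung

end Summit.ResolutionOfSingularities.ResolutionOfSingularities.Theorems

end
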